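import Summits.BirchSwinnertonDyer.BirchSwinnertonDyer.Theorems.GenusKolyvaginAtTwoGenusPrimitiveSupplyAtTwoTranspositionReduction
import Summits.BirchSwinnertonDyer.BirchSwinnertonDyer.Theorems.GenusKolyvaginAtTwoGenusPrimitiveSupplyAtTwoArchimedeanEgg
import Summits.BirchSwinnertonDyer.BirchSwinnertonDyer.Theorems.GenusKolyvaginAtTwoGenusPrimitiveSupplyAtTwoTwistingPrimeLocal
import Summits.BirchSwinnertonDyer.Rank1Residual.F1Sign2.TranspositionDoorAtTwo
import Mathlib.NumberTheory.Padics.HeightOneSpectrum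
import HarnessLib

/-!
# Route `GenusKolyvaginAtTwo`, crux #2 `GenusPrimitiveSupplyAtTwo` (stmt-BirchSwinnertonDyer-22136):
# THE KUMMER READING OF THE TRANSPOSITION DOOR — «`E(ℚ)` meets the non-norm coset at `q`» (the cell's
# `F1Sign2.TranspositionDoor.MeetsNonNormAt W q`, reduction currency) ⟺ «some class of `Sel₂(W)` is non-trivial at `q`»

Width seat `bsd-line-gk2-p4` g13 (cell `bsd-f1-sign2`), sequel of `…TranspositionReduction` (the two reductions of a rational
point agree; Hensel on rational points) and the `q`-adic twin of gk2-p5's `…ArchimedeanEgg` (§74 there: the egg is the real place of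
`Sel₂(W)`). THEOREMS ONLY (no definition, no named fact, no `sorry`); helper `--supports stmt-BirchSwinnertonDyer-22136`; no item
is closed; BSD is not proved by any of this.

WHAT. For `W/ℚ` globally minimal elliptic, `v` the place of an odd prime `q ∤ Δ_W`:
* `exists_two_smul_adicCompletion_iff_padic` — `P_v ∈ 2E(ℚ_v) ⟺ P ∈ 2E(ℚ_q)` for a rational point `P` (transport of coordinates
  along Mathlib's `ℚ`-algebra isomorphism `padicEquiv v : ℚ_v ≃ ℚ_[q]`);
* `exists_mem_selmerGroup_localization_ne_zero_of_meetsNonNormAt` — **`MeetsNonNormAt W q ⟹` some class of `Sel₂(W)` is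
  non-trivial at `v`** (ANY such `W`: the Kummer class `κ(P)` of the door point; `loc_v κ(P) = 0 ⟺ P_v ∈ 2E(ℚ_v)`
  (`localization_kummerMapTorsion_eq_zero_iff`) `⟺ P̃ ∈ 2Ẽ(𝔽_q)` (Hensel, `exists_smul_reducePointAt_iff_exists_smul_padic`));
* `forall_mem_selmerGroup_localization_eq_zero_of_not_meetsNonNormAt` — **`¬ MeetsNonNormAt W q ⟹ Sel₂(W)` is STRICT at `v`**
  under `Ш(W)[2] = 0` (every Selmer class is then `κ(P)` of a rational point);
* `meetsNonNormAt_iff_exists_localization_ne_zero` — the dictionary as an `iff` (`Ш(W)[2] = 0`).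
This is Kramer 1981 Prop. 3 read for the `2`-Selmer group: at a ramified good odd prime the local norm index is
`E(ℚ_q)/N E(K_w) ≅ Ẽ(𝔽_q)/2Ẽ(𝔽_q)`, and «`E(ℚ)` meets the non-norm coset» is «`loc_q Sel₂(W) ≠ 0`» — the `V_T ≠ 0` branch of
Mazur–Rubin 2010 Cor. 3.4 (i) at `T = {q}`.

References: [Kramer1981] Prop. 3; [MazurRubin2010] Def. 3.1, Lemma 2.2 (i), Cor. 3.4 (i); [SilvermanAEC2009] VII.2.1, VIII.§2, X.4.2 (a).
-/

set_option linter.dupNamespace false -- tree convention: `Summit.BirchSwinnertonDyer.BirchSwinnertonDyer.Theorems` (summit = sub-problem)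
set_option autoImplicit false

noncomputable section

open scoped Classical ContRepresentation

namespace Summit.BirchSwinnertonDyer.BirchSwinnertonDyer.Theorems.GenusKolyTransp

open WeierstrassCurve Field NumberField IsDedekindDomain Function
open Literature.NumberTheory.EllipticCurves Literature.NumberTheory.GaloisRepresentations
open Literature.NumberTheory.GaloisCohomology
open Summit.BirchSwinnertonDyer.Rank1Residual.F1Sign2
open Summit.BirchSwinnertonDyer.Rank1Residual.F1Sign2.TranspositionDoor (MeetsNonNormAt)
open Summit.BirchSwinnertonDyer.BirchSwinnertonDyer.Theorems.GenusKolyArch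
  (localization_kummerMapTorsion_eq_zero_iff hdiv_two)
open Summit.BirchSwinnertonDyer.BirchSwinnertonDyer.Theorems.GenusKolyTwistingPrime (primesEquiv_eq)
open Rat.HeightOneSpectrum (primesEquiv)

variable (W : WeierstrassCurve ℚ) [W.IsElliptic]

/-! ## §5 `2`-divisibility of a rational point in `E(ℚ_v)` and in `E(ℚ_q)` -/

omit [W.IsElliptic] in
/-- **`P ∈ nE(ℚ_v) ⟺ P ∈ nE(ℚ_q)`** for a rational point `P` and the place `v` of the prime `q` — the tree's two currencies for
the `q`-adic points (`ℚ_v = v.adicCompletion ℚ`, the Selmer machinery's; Mathlib's `ℚ_[q]`, the formal group's), identified along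
Mathlib's `ℚ`-algebra isomorphism `padicEquiv v` (functoriality of points, `Affine.Point.map_baseChange`). [folklore]
[cite: SilvermanAEC2009, VII.§3 (E(K) and E(K_v))] -/
theorem exists_two_smul_adicCompletion_iff_padic (v : HeightOneSpectrum (𝓞 ℚ)) {q : ℕ} [Fact q.Prime]
    (hqv : (q : 𝓞 ℚ) ∈ v.asIdeal) (n : ℕ) (P : W.toAffine.Point) :
    (∃ R : (W.baseChange (v.adicCompletion ℚ)).toAffine.Point,
        n • R = Affine.Point.baseChange (W' := W) ℚ (v.adicCompletion ℚ) P) ↔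
      ∃ R : (W.baseChange ℚ_[q]).toAffine.Point, n • R = Affine.Point.baseChange (W' := W) ℚ ℚ_[q] P := by
  obtain rfl : ((primesEquiv v : Nat.Primes) : ℕ) = q := primesEquiv_eq (Fact.out) hqv
  let e : v.adicCompletion ℚ ≃ₐ[ℚ] ℚ_[((primesEquiv v : Nat.Primes) : ℕ)] :=
    (Rat.HeightOneSpectrum.adicCompletion.padicEquiv (R := 𝓞 ℚ) v).toAlgEquiv
  constructor
  · rintro ⟨R, hR⟩
    refine ⟨Affine.Point.map (W' := W) (e : v.adicCompletion ℚ →ₐ[ℚ] _) R, ?_⟩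
    rw [← map_nsmul, hR, Affine.Point.map_baseChange]
  · rintro ⟨R, hR⟩
    refine ⟨Affine.Point.map (W' := W) (e.symm : _ →ₐ[ℚ] v.adicCompletion ℚ) R, ?_⟩
    rw [← map_nsmul, hR, Affine.Point.map_baseChange]

/-! ## §6 The Kummer reading of the door -/

variable [W.IsGloballyMinimal]

/-- **`MeetsNonNormAt W q ⟹` some class of `Sel₂(W)` is non-trivial at the place `v` of `q`** (`W/ℚ` globally minimal, `q ∤ 2Δ_W`;
no hypothesis on rank, torsion or `Ш`): the Kummer class `κ(P)` of a rational point `P` with `P̃ ∉ 2Ẽ(𝔽_q)` lies in `Sel₂(W)` and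
`loc_v κ(P) = κ_v(P_v) ≠ 0`, since `κ_v(P_v) = 0 ⟺ P_v ∈ 2E(ℚ_v) ⟺ P ∈ 2E(ℚ_q) ⟺ P̃ ∈ 2Ẽ(𝔽_q)` (Hensel).
[cite: Kramer1981, Prop. 3] [cite: SilvermanAEC2009, Prop. VII.2.1 and X.§4 diagram (**)] -/
theorem exists_mem_selmerGroup_localization_ne_zero_of_meetsNonNormAt (v : HeightOneSpectrum (𝓞 ℚ)) {q : ℕ}
    [Fact q.Prime] (hqv : (q : 𝓞 ℚ) ∈ v.asIdeal) (hq2 : q ≠ 2) (hq : ¬ (q : ℤ) ∣ minimalDiscriminantInt W)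
    (h : MeetsNonNormAt W q) :
    ∃ c ∈ (W.kummerSelmerStructure ((2 : ℕ) : ℤ)).selmerGroup,
      galoisCohomology.localization (W.torsionGaloisModule ((2 : ℕ) : ℤ)) (Sum.inr v) 1 c ≠ 0 := by
  obtain ⟨P, hP⟩ := h
  have h2 : ((2 : ℕ) : ℤ) ≠ 0 := by norm_num
  have hn : ¬ q ∣ 2 := fun h ↦ hq2 ((Nat.prime_dvd_prime_iff_eq (Fact.out) Nat.prime_two).mp h)
  refine ⟨kummerMapTorsion W _ (hdiv_two W) P, ?_, ?_⟩
  · exact (SetLike.ext_iff.mp (W.selmerGroup_eq_selmerGroup_kummerSelmerStructure _) _).mp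
      (WeierstrassCurve.kummerMapTorsion_mem_selmerGroup W _ (hdiv_two W) _)
  · intro h0
    rw [localization_kummerMapTorsion_eq_zero_iff W h2 (hdiv_two W)] at h0
    obtain ⟨R, hR⟩ := h0
    have hv : ∃ R : (W.baseChange (v.adicCompletion ℚ)).toAffine.Point,
        (2 : ℕ) • R = Affine.Point.baseChange (W' := W) ℚ (v.adicCompletion ℚ) P :=
      ⟨R, by rw [← natCast_zsmul]; exact hR⟩
    rw [exists_two_smul_adicCompletion_iff_padic W v hqv] at hv
    obtain ⟨Q, hQ⟩ := (exists_smul_reducePointAt_iff_exists_smul_padic q W hq hn P).mpr hv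
    exact hP Q hQ

/-- **`¬ MeetsNonNormAt W q ⟹ Sel₂(W)` is STRICT at the place `v` of `q`** under `Ш(W)[2] = 0` (`W/ℚ` globally minimal,
`q ∤ 2Δ_W`): every Selmer class dies in `H¹(ℚ, E)` (its image lies in `Ш(W) ∩ H¹(ℚ, E)[2] = 0`), so it is `κ(P)` for a rational
`P` (exactness of the Kummer sequence); `P̃ ∈ 2Ẽ(𝔽_q)` (the door is shut), so `P ∈ 2E(ℚ_q)` (Hensel) and `loc_v κ(P) = 0`.
[cite: Kramer1981, Prop. 3] [cite: SilvermanAEC2009, Thm X.4.2(a) and Prop. VII.2.1] -/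
theorem forall_mem_selmerGroup_localization_eq_zero_of_not_meetsNonNormAt (v : HeightOneSpectrum (𝓞 ℚ)) {q : ℕ}
    [Fact q.Prime] (hqv : (q : 𝓞 ℚ) ∈ v.asIdeal) (hq2 : q ≠ 2) (hq : ¬ (q : ℤ) ∣ minimalDiscriminantInt W)
    (hSha : ShaTwoTrivial W) (h : ¬ MeetsNonNormAt W q) :
    ∀ c ∈ (W.kummerSelmerStructure ((2 : ℕ) : ℤ)).selmerGroup,
      galoisCohomology.localization (W.torsionGaloisModule ((2 : ℕ) : ℤ)) (Sum.inr v) 1 c = 0 := by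
  intro c hc
  have h2 : ((2 : ℕ) : ℤ) ≠ 0 := by norm_num
  have hn : ¬ q ∣ 2 := fun h ↦ hq2 ((Nat.prime_dvd_prime_iff_eq (Fact.out) Nat.prime_two).mp h)
  have hc' : c ∈ selmerGroup W ((2 : ℕ) : ℤ) :=
    (SetLike.ext_iff.mp (W.selmerGroup_eq_selmerGroup_kummerSelmerStructure _) c).mpr hc
  -- `c` dies in `H¹(ℚ, E)`: its image lies in `Ш(W) ∩ H¹(ℚ, E)[2] = 0`
  have himg : torsionH1ToH1 W _ c ∈ W.sha ⊓ AddSubgroup.torsionBy W.galH1 ((2 : ℕ) : ℤ) := by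
    rw [← WeierstrassCurve.map_torsionH1ToH1_selmerGroup_holds W h2]
    exact ⟨c, hc', rfl⟩
  have hzero : torsionH1ToH1 W _ c = 0 :=
    hSha _ (AddSubgroup.mem_inf.mp himg).1 (AddSubgroup.torsionBy.nsmul_iff.mp (AddSubgroup.mem_inf.mp himg).2)
  -- hence `c = κ(P)` for a rational point `P`
  obtain ⟨P, hP⟩ := mem_range_kummerMapTorsion_of_torsionH1ToH1_eq_zero W _ (hdiv_two W) c hzero
  rw [← hP, localization_kummerMapTorsion_eq_zero_iff W h2 (hdiv_two W)]
  -- the door is shut at `P`: `P̃ ∈ 2Ẽ(𝔽_q)`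
  have hdoor : ∃ Q : (reductionAtPrime W q).toAffine.Point, reducePointAt W q P = 2 • Q := by
    by_contra hne
    push Not at hne
    exact h ⟨P, hne⟩
  rw [exists_smul_reducePointAt_iff_exists_smul_padic q W hq hn P, ← exists_two_smul_adicCompletion_iff_padic W v hqv] at hdoor
  obtain ⟨R, hR⟩ := hdoor
  exact ⟨R, by rw [natCast_zsmul]; exact hR⟩

/-- **The door at `q` is the place `v` of `Sel₂(W)`**: for `W/ℚ` globally minimal with `Ш(W)[2] = 0` and an odd good prime `q`,
`E(ℚ)` meets the non-norm coset at `q` iff some class of `Sel₂(W)` is non-trivial at the place of `q` (Kramer's local norm index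
`E(ℚ_q)/N E(K_w) ≅ Ẽ(𝔽_q)/2Ẽ(𝔽_q)` at a ramified good odd prime, read through the Kummer map).
[cite: Kramer1981, Prop. 3] [cite: MazurRubin2010, Def. 3.1 and Cor. 3.4 (i)] -/
theorem meetsNonNormAt_iff_exists_localization_ne_zero (v : HeightOneSpectrum (𝓞 ℚ)) {q : ℕ} [Fact q.Prime]
    (hqv : (q : 𝓞 ℚ) ∈ v.asIdeal) (hq2 : q ≠ 2) (hq : ¬ (q : ℤ) ∣ minimalDiscriminantInt W) (hSha : ShaTwoTrivial W) :
    MeetsNonNormAt W q ↔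
      ∃ c ∈ (W.kummerSelmerStructure ((2 : ℕ) : ℤ)).selmerGroup,
        galoisCohomology.localization (W.torsionGaloisModule ((2 : ℕ) : ℤ)) (Sum.inr v) 1 c ≠ 0 := by
  refine ⟨exists_mem_selmerGroup_localization_ne_zero_of_meetsNonNormAt W v hqv hq2 hq, fun ⟨c, hc, hne⟩ ↦ ?_⟩
  by_contra hdoor
  exact hne (forall_mem_selmerGroup_localization_eq_zero_of_not_meetsNonNormAt W v hqv hq2 hq hSha hdoor c hc)

end Summit.BirchSwinnertonDyer.BirchSwinnertonDyer.Theorems.GenusKolyTransp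

end
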